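import Mathlib.RingTheory.SimpleModule.Basic
import Mathlib.RingTheory.Ideal.Quotient.Operations
import Mathlib.RingTheory.Jacobson.Radical
import Mathlib.RingTheory.Adjoin.Basic
import Mathlib.LinearAlgebra.Trace
import Literature.AlgebraicGeometry.Motives.Correspondences
import Literature.Geometry.Kaehler.Kaehler
import Literature.Geometry.Kaehler.AnalyticSet
import Literature.NumberTheory.Transcendental.ComplexForms
import Literature.NumberTheory.Transcendental.DeRhamTheorem
import HarnessLib

-- provenance: harness21/H21/H21/Statements/Hodge/Sweep2.lean @ 3a9b654 (interim HEAD d8f2665); M5 mechanical rewrite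
/-!
# Hodge family, statement sweep 2

Family `hodge` (trunks MotiveAbstract, Kaehler). This file states the part of the remaining target
statements of the family that is statable against Mathlib and the accepted H21 preludes with a
small amount of local glue.

## Covered

* **hodge.S28** (Scholl, *Classical motives* §1; Jannsen, *Motives, numerical equivalence, and
  semi-simplicity*, Invent. Math. 107 (1992), Thm. 1 and its proof), in the following faithful
  *per-variety* form. Jannsen's Theorem 1 says that for an adequate equivalence relation `∼` and
  a coefficient field `F` of characteristic zero the following are equivalent:
  (a) the category of motives `Mot_∼(k, F)` is semisimple abelian;
  (b) for every smooth projective `X` (of dimension `d`) the `F`-algebra of degree-`0`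
      correspondences `A^d_∼(X × X, F)` is a finite-dimensional semisimple `F`-algebra;
  (c) `∼` is numerical equivalence.
  We formalise, for a Weil cohomology theory `W : Literature.WeilCohomology k K`:
  the `K`-algebra `W.corrAlgebra d X` of homological correspondences of degree `0`
  (`A^d_hom(X × X) ⊗ K`, realised as the `K`-subalgebra of `∏ᵢ End_K Hⁱ(X)` generated by the
  operators induced by rational algebraic classes in `H²ᵈ(X × X)`), the two-sided ideal
  `W.numTrivialIdeal d X` of numerically trivial correspondences (the radical of the
  Lefschetz-number form `(f, g) ↦ ∑ᵢ (-1)ⁱ tr(fᵢ gᵢ)`), the quotient `K`-algebra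
  `W.NumCorrAlgebra d X = A^d_num(X × X) ⊗ K`, and the theorems
  `jacobson_le_numTrivialIdeal` (Jannsen's key lemma), `numCorrAlgebra_finite` and
  `isSemisimpleRing_numCorrAlgebra` (clause (c) ⇒ (b) of Jannsen's Theorem 1, i.e. the content
  of "numerical motives form a semisimple abelian category" before passing to the pseudo-abelian
  envelope), all *proved* here from the Weil axioms (finite dimensionality and vanishing above
  degree `2n`, `corrOp_finite`) and Mathlib's artinian-ring theory (`IsSemiprimaryRing`: the
  Jacobson radical of an artinian ring is nilpotent and the quotient by it is semisimple;
  `RingHom.isSemisimpleRing_of_surjective`; `LinearMap.isNilpotent_trace_of_isNilpotent`) —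
  exactly Jannsen's half-page argument once numerical triviality is the radical of the trace form.

* **hodge.S23**, Zucker's clause, is a *named fact* `def zucker_exists_hodgeClass_not_analytic :
  Prop` (D-0014: a published theorem not provable from the present Kähler package is vendored as
  a cited `Prop`, consumers take `(h : zucker_exists_hodgeClass_not_analytic)`).

  **Clauses of hodge.S28 NOT covered:** the *category* `Mot_∼(k, F)` of pure motives modulo a
  general adequate equivalence relation (Scholl §1) and hence clause (a) and the converse
  "only for numerical equivalence" ((a) ⇒ (c)). Missing notions: *adequate equivalence relations*
  on cycles in general and the *intersection product / composition of correspondences on Chow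
  groups* (H21 has the four named relations `ratTrivial ≤ algTrivial ≤ homTrivial ≤ numTrivial`
  as subgroups only, `Literature.Prelude.MotiveL.AlgebraicEquivalence`, and composition of
  correspondences only through the operators they induce on a Weil cohomology,
  `PreWeilCohomology.IsInducedBy`); with those, Mathlib's `CategoryTheory.Idempotents.Karoubi`
  would supply the pseudo-abelian envelope. Jannsen's proof of (a) ⇒ (c) uses the Tate-twisted
  objects `𝟙(-j)` of that category and is not expressible per variety.

* **hodge.S23**, *Zucker's clause only* (Zucker, Compositio Math. 34 (1977), App. B, as quoted
  in Voisin, IMRN 2002 no. 20, §1): `zucker_exists_hodgeClass_not_analytic` — there is a compact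
  Kähler manifold homeomorphic to a torus carrying a non-zero rational Hodge class of some type
  `(p, p)`, `0 < p < dim`, and no analytic subset of pure codimension `p`; so the Kähler analogue
  of the Hodge conjecture with *analytic cycles* fails. Stated with the accepted Kähler package:
  `Literature.Geometry.Kaehler.IsKaehlerManifold` (`Kaehler.Kaehler`), `Literature.NumberTheory.Transcendental.hodgePQ` and `Literature.NumberTheory.Transcendental.ComplexDeRhamIsoFamily`
  (`TranscendKaehlerL.ComplexForms` / `.DeRhamTheorem`, exactly as in the accepted
  `H21/Statements/Hodge/HodgeDecomposition.lean`), `Literature.Geometry.Kaehler.HasPureCodim` (`Kaehler.AnalyticSet`),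
  and G04 singular cohomology. Local glue: `IsRationalClass` (a class in `Hⁿ(X; ℂ)` represented
  by a `ℚ`-valued cocycle, i.e. in the image of `Hⁿ(X; ℚ)`).

  **Clause of hodge.S23 NOT covered (the main one):** Voisin's Theorem 1 — a `4`-dimensional
  complex torus with `Hdg⁴(X, ℚ) ≠ 0` on which `c₂(𝓕) = 0` for every coherent sheaf `𝓕`, so that
  Hodge classes are not even rational combinations of Chern classes of coherent sheaves. Missing
  notions, unchanged since sweep 1: *coherent analytic sheaves* (or even holomorphic / topological
  complex vector bundles) on a compact complex manifold together with their *Chern classes* in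
  `H²ⁱ(X, ℚ)` (H21's `Literature.Prelude.MotiveL.ChernClasses` is for algebraic bundles with values in a
  Weil cohomology of smooth projective varieties; Mathlib has no Chern classes of vector
  bundles), and *complex tori `ℂⁿ/Λ` as complex manifolds* with their Hodge structure of Weil
  type (Mathlib has no quotient-manifold construction beyond `AddCircle`; for Zucker's clause an
  abstract `M ≃ₜ (S¹)²ⁿ` suffices).

## Design notes (hodge.S23, Zucker's clause)

* The manifold, its instances and the homeomorphism with `(S¹)²ⁿ = Fin (2n) → AddCircle 1` are
  existentially quantified (model space `Fin n → ℂ`, universe `0` because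
  `ComplexDeRhamIsoFamily E` ranges over manifolds in the universe of `E`, as in
  `HodgeDecomposition.lean`). A compact Kähler manifold homeomorphic to a torus *is* a complex
  torus (Catanese 2002), so "complex torus" is rendered faithfully without `ℂⁿ/Λ`.
* "Rational Hodge class of type `(p, p)`" is: a de Rham class `c ∈ H^{p,p}(M)` whose singular
  image `e M (2p) c` is rational and non-zero, *for every* natural complex de Rham isomorphism
  family `e` (existence: `exists_complexDeRhamIsoFamily`); no choice of comparison enters, and
  both `H^{p,p}` and the rational lattice `⊗ ℂ` are stable under the scalar ambiguity of `e`.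
* The codimension `p` is existential (`0 < p < n`): the counterexamples in print are complex
  tori carrying rational `(1, 1)`-classes (hence also their squares, of type `(2, 2)`) but no
  proper positive-dimensional analytic subsets; we do not pin the printed choice of degree.

## Design notes (hodge.S28)

* *Why operators.* H21 composes correspondences only via induced operators
  (`isAlgebraicGradedOp_comp`), so `A^d_hom(X × X)` is modelled inside
  `W.CorrOp X = ∀ i, Module.End K (Hⁱ(X))` (Kleiman 1968 §1.3: modulo homological equivalence a
  correspondence *is* its operator, by Künneth and Poincaré duality). We take the `K`-subalgebra
  *generated* by the induced operators (`Algebra.adjoin`), so no closure proof enters the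
  definition; by `isAlgebraicGradedOp_comp` and the axiom
  `Literature.AlgebraicGeometry.Motives.WeilCohomology.exists_isInducedBy_id` it is just their `K`-span.
* *Why the trace form.* By the Lefschetz trace formula (Kleiman 1968 Prop. 1.3.6, a formal
  consequence of the Weil axioms) `⟨u · ᵗv⟩ = ∑ᵢ (-1)ⁱ tr(v ∘ u | Hⁱ(X))`, and transposition
  permutes degree-`0` correspondences, so a correspondence is numerically trivial iff it lies in
  the radical of the Lefschetz-number form restricted to `corrAlgebra`. Defining the ideal as this
  radical makes "two-sided ideal" provable from cyclicity of the trace alone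
  (`LinearMap.trace_mul_comm`), so the quotient algebra is an honest Mathlib `Ideal` quotient
  (`Ideal.instHasQuotient` for two-sided ideals). Since `A^d_num(X × X)_ℚ` is finite dimensional
  and the form is defined over `ℚ`,
  `W.NumCorrAlgebra d X ≅ A^d_num(X × X)_ℚ ⊗_ℚ K = A^d_num(X × X, K)` in Jannsen's notation
  (with `F = K`).
* Mathlib supplies `IsSemisimpleRing`, `Ring.jacobson`, `Algebra.adjoin`, `LinearMap.trace`,
  two-sided ideal quotients with their `Algebra` instance; searched Mathlib for `Motive`,
  `correspondence`, `numerical equivalence`, `Jannsen`: nothing.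

## References

* A. J. Scholl, *Classical motives*, in: Motives (Seattle 1991), Proc. Sympos. Pure Math. 55
  Part 1 (1994), 163–187, §1.
* U. Jannsen, *Motives, numerical equivalence, and semi-simplicity*, Invent. Math. 107 (1992),
  447–452, Thm. 1, Lemma 1, Cor. 1.
* S. Kleiman, *Algebraic cycles and the Weil conjectures* (1968), §1.3 (Prop. 1.3.6), §3.
* S. Zucker, *The Hodge conjecture for cubic fourfolds*, Compositio Math. 34 (1977), 199–209,
  Appendix B.
* F. Catanese, *Deformation types of real and complex manifolds*, in: Contemporary trends in
  algebraic geometry and algebraic topology (2002) (Kähler manifolds with the cohomology of a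
  torus).
* C. Voisin, *A counterexample to the Hodge conjecture extended to Kähler varieties*, IMRN 2002
  no. 20, 1057–1075 (arXiv:math/0112247; held, §1 p. 2 quoted at
  `zucker_exists_hodgeClass_not_analytic`).
-/

universe u v

open CategoryTheory AlgebraicGeometry MonoidalCategory

noncomputable section

namespace Literature.AlgebraicGeometry.Motives

section Hodge

variable {k : Type u} [Field k] {K : Type v} [Field K] [CharZero K] (W : WeilCohomology k K)

/-! ## Degree-`0` correspondences as graded operators -/

/-- Degree-preserving graded `K`-linear endomorphisms of `H•(X)`: families
`(fᵢ : Hⁱ(X) →ₗ Hⁱ(X))ᵢ`, a `K`-algebra under componentwise composition. Degree-`0`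
correspondences act through such operators (Kleiman 1968 §1.3). [cite: Kleiman1968, §1.3] -/
abbrev CorrOp (X : SchemeOver k) : Type u := ∀ i : ℕ, Module.End K (W.obj X i)

variable (n : ℕ) (X : SchemeOver k)

/-- `f : ∏ᵢ End Hⁱ(X)` *is a homological correspondence of degree `0`* on `X` (of dimension `n`):
there is a rational algebraic class `u ∈ Aⁿ(X × X) ⊗ ℚ ⊆ H²ⁿ(X × X)` inducing every component
`fᵢ : Hⁱ(X) → Hⁱ(X)` (Kleiman 1968 §1.3; Scholl 1994 §1.3, `Corr⁰(X, X)`; Jannsen 1992, the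
algebra `Aⁿ_hom(X × X)`). Components in degrees `i > 2n` are unconstrained but live in the zero
space. [cite: Kleiman1968, §1.3] -/
def IsHomCorrespondence (f : CorrOp W X) : Prop :=
  ∃ u ∈ W.ratAlgebraicClasses (X ⊗ X) n, ∀ (i i' : ℕ) (h : i + i' = 2 * n),
    W.IsInducedBy n n u (f i) h (by omega)

/-- The `K`-algebra `Aⁿ_hom(X × X) ⊗ K` of **homological correspondences of degree `0`** with
`K`-coefficients, realised as the `K`-subalgebra of `∏ᵢ End_K Hⁱ(X)` generated by the operators
of rational algebraic correspondences (Jannsen 1992, `A^d_hom(X × X, F)`; Scholl 1994 §1.3).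
By `WeilCohomology.isAlgebraicGradedOp_comp` the generators are already closed under
composition, so this is their `K`-span. [cite: Jannsen1992, p. 448 (A^d_hom(X × X, F))] -/
def corrAlgebra : Subalgebra K (CorrOp W X) :=
  Algebra.adjoin K {f | IsHomCorrespondence W n X f}

/-- The **Lefschetz-number form** on graded operators of `H•(X)` (`n = dim X`):
`λ(f, g) = ∑_{i ≤ 2n} (-1)ⁱ tr(fᵢ ∘ gᵢ | Hⁱ(X))`. For correspondences `u`, `v` of degree `0` this
is the intersection number `⟨v ∘ u · ᵗΔ⟩ = ⟨u · ᵗv⟩` by the Lefschetz trace formula (Kleiman 1968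
Prop. 1.3.6; Jannsen 1992, proof of Thm. 1). [cite: Kleiman1968, Prop. 1.3.6] -/
def lefschetzNumberForm : CorrOp W X →ₗ[K] CorrOp W X →ₗ[K] K :=
  ∑ i ∈ Finset.range (2 * n + 1),
    ((-1 : K) ^ i) • ((LinearMap.mul K (Module.End K (W.obj X i))).compr₂
      (LinearMap.trace K (W.obj X i))).compl₁₂ (LinearMap.proj i) (LinearMap.proj i)

/-- Unfolding the Lefschetz-number form. [folklore] -/
lemma lefschetzNumberForm_apply (f g : CorrOp W X) :
    lefschetzNumberForm W n X f g =
      ∑ i ∈ Finset.range (2 * n + 1), (-1 : K) ^ i * LinearMap.trace K (W.obj X i) (f i * g i) := by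
  simp [lefschetzNumberForm, LinearMap.sum_apply, LinearMap.smul_apply]

/-- `λ(f g, h) = λ(f, g h)` (associativity of composition). [folklore] -/
lemma lefschetzNumberForm_mul_left (f g h : CorrOp W X) :
    lefschetzNumberForm W n X (f * g) h = lefschetzNumberForm W n X f (g * h) := by
  simp only [lefschetzNumberForm_apply, Pi.mul_apply, mul_assoc]

/-- `λ(f g, h) = λ(g, h f)` (cyclicity of the trace in each degree). [folklore] -/
lemma lefschetzNumberForm_mul_comm (f g h : CorrOp W X) :
    lefschetzNumberForm W n X (f * g) h = lefschetzNumberForm W n X g (h * f) := by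
  simp only [lefschetzNumberForm_apply, Pi.mul_apply]
  refine Finset.sum_congr rfl fun i _ ↦ ?_
  rw [mul_assoc (f i), LinearMap.trace_mul_comm, mul_assoc]

/-- The ideal `𝒩 ⊆ Aⁿ_hom(X × X) ⊗ K` of **numerically trivial correspondences**: those `f` with
`λ(f, g) = 0` for every homological correspondence `g` (Jannsen 1992, the kernel of
`A_hom(X × X) → A_num(X × X)`, identified with the radical of the trace form in the proof of
Thm. 1 via the Lefschetz trace formula, Kleiman 1968 Prop. 1.3.6). [cite: Jannsen1992, proof of Thm. 1] -/
def numTrivialIdeal : Ideal ↥(corrAlgebra W n X) where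
  carrier := {f | ∀ g ∈ corrAlgebra W n X, lefschetzNumberForm W n X f g = 0}
  zero_mem' := fun g _ ↦ by simp
  add_mem' := fun {f f'} hf hf' g hg ↦ by simp [hf g hg, hf' g hg]
  smul_mem' := fun c {f} hf g hg ↦ by
    change lefschetzNumberForm W n X ((c : CorrOp W X) * f) g = 0
    rw [lefschetzNumberForm_mul_comm]
    exact hf _ (mul_mem hg c.2)

/-- Membership in the ideal of numerically trivial correspondences, unfolded. [folklore] -/
lemma mem_numTrivialIdeal_iff {f : ↥(corrAlgebra W n X)} :
    f ∈ numTrivialIdeal W n X ↔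
      ∀ g ∈ corrAlgebra W n X, lefschetzNumberForm W n X f g = 0 := Iff.rfl

/-- The ideal of numerically trivial correspondences is two-sided (Jannsen 1992, Lemma 1:
`λ(f g, h) = λ(f, g h)`). [cite: Jannsen1992, Lemma 1] -/
instance numTrivialIdeal_isTwoSided : (numTrivialIdeal W n X).IsTwoSided where
  mul_mem_of_left := fun {f} g hf h hh ↦ by
    change lefschetzNumberForm W n X ((f : CorrOp W X) * g) h = 0
    rw [lefschetzNumberForm_mul_left]
    exact hf _ (mul_mem g.2 hh)

/-- The `K`-algebra `Aⁿ_num(X × X) ⊗ K` of **correspondences of degree `0` modulo numerical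
equivalence** (Jannsen 1992, `A^d_num(X × X, F)`; Scholl 1994 §1: the endomorphism algebra of the
numerical motive `h(X)`), the quotient of `corrAlgebra` by `numTrivialIdeal`. [cite: Jannsen1992, p. 448 (A^d_num(X × X, F))] -/
abbrev NumCorrAlgebra : Type u := ↥(corrAlgebra W n X) ⧸ numTrivialIdeal W n X

/-! ## Jannsen's theorem -/

variable {n X}

/-- For `X` smooth projective of dimension `n`, the algebra `∏ᵢ End_K Hⁱ(X)` of graded operators
is finite dimensional over `K`: each `Hⁱ(X)` is finite dimensional and `Hⁱ(X) = 0` for `i > 2n`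
(Weil axiom (A), Kleiman 1968 §1.2), so restriction to degrees `≤ 2n` is injective.
[cite: Kleiman1968, §1.2 (A)] -/
theorem corrOp_finite (hX : IsSmoothProjective n X) : Module.Finite K (CorrOp W X) := by
  haveI := W.finite_obj hX
  let π : CorrOp W X →ₗ[K] ((i : Fin (2 * n + 1)) → Module.End K (W.obj X (i : ℕ))) :=
    LinearMap.pi fun i ↦ LinearMap.proj (i : ℕ)
  refine Module.Finite.of_injective π fun f g h ↦ funext fun i ↦ ?_
  by_cases hi : i < 2 * n + 1
  · exact congr_fun h ⟨i, hi⟩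
  · haveI := W.subsingleton_obj hX (i := i) (by omega)
    exact LinearMap.ext fun x ↦ Subsingleton.elim _ _

/-- For `X` smooth projective of dimension `n`, the `K`-algebra `Aⁿ_hom(X × X) ⊗ K` of
homological correspondences of degree `0` is finite dimensional over `K` (Kleiman 1968,
Thm. 3.5 / §1.2 (A): it embeds in `∏_{i ≤ 2n} End_K Hⁱ(X)`; Jannsen 1992, proof of Thm. 1).
[cite: Kleiman1968, §1.2 (A) and Thm. 3.5] -/
theorem corrAlgebra_finite (hX : IsSmoothProjective n X) :
    Module.Finite K ↥(corrAlgebra W n X) := by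
  haveI := corrOp_finite W hX
  exact Module.Finite.of_injective (corrAlgebra W n X).val.toLinearMap Subtype.val_injective

/-- For `X` smooth projective of dimension `n`, the finite-dimensional `K`-algebra
`Aⁿ_hom(X × X) ⊗ K` is (left) artinian (Jannsen 1992, proof of Thm. 1: "a finite-dimensional
`F`-algebra"). [cite: Jannsen1992, proof of Thm. 1] -/
theorem isArtinianRing_corrAlgebra (hX : IsSmoothProjective n X) :
    IsArtinianRing ↥(corrAlgebra W n X) := by
  haveI := corrAlgebra_finite W hX
  exact IsArtinianRing.of_finite K _

/-- **hodge.S28** (Jannsen, Invent. Math. 107 (1992), Lemma 1 and proof of Thm. 1). For `X`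
smooth projective of dimension `n`, the Jacobson radical of the finite-dimensional `K`-algebra
`Aⁿ_hom(X × X) ⊗ K` consists of numerically trivial correspondences: for `f` in the radical and
any `g`, `f g` lies in the (nilpotent) radical, so all graded traces of `f g` vanish and
`λ(f, g) = 0`. Proved here from the Weil axioms (finite dimensionality) and Mathlib's
`IsSemiprimaryRing` (the radical of an artinian ring is nilpotent) and
`LinearMap.isNilpotent_trace_of_isNilpotent`. [cite: Jannsen1992, Lemma 1 and proof of Thm. 1] -/
theorem jacobson_le_numTrivialIdeal (hX : IsSmoothProjective n X) :
    Ring.jacobson ↥(corrAlgebra W n X) ≤ numTrivialIdeal W n X := by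
  haveI := isArtinianRing_corrAlgebra W hX
  -- shortcut instance: keeps the search for `Pow (Ideal _) ℕ` on the subalgebra cheap
  haveI : IsScalarTower ↥(corrAlgebra W n X) ↥(corrAlgebra W n X) ↥(corrAlgebra W n X) :=
    IsScalarTower.left _
  intro f hf
  rw [mem_numTrivialIdeal_iff]
  intro g hg
  have hfg : (f * ⟨g, hg⟩ : ↥(corrAlgebra W n X)) ∈ Ring.jacobson ↥(corrAlgebra W n X) :=
    Ideal.mul_mem_right _ _ hf
  obtain ⟨m, hm⟩ := IsSemiprimaryRing.isNilpotent (R := ↥(corrAlgebra W n X))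
  have hnil : IsNilpotent ((f : CorrOp W X) * g) := by
    refine ⟨m, ?_⟩
    have h1 : (f * ⟨g, hg⟩ : ↥(corrAlgebra W n X)) ^ m ∈ Ring.jacobson ↥(corrAlgebra W n X) ^ m :=
      Ideal.pow_mem_pow hfg m
    rw [hm, Ideal.zero_eq_bot, Ideal.mem_bot] at h1
    simpa using congrArg Subtype.val h1
  rw [lefschetzNumberForm_apply]
  refine Finset.sum_eq_zero fun i _ ↦ ?_
  have hi : IsNilpotent (((f : CorrOp W X) * g) i) := hnil.map (Pi.evalRingHom _ i)
  rw [Pi.mul_apply] at hi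
  rw [(LinearMap.isNilpotent_trace_of_isNilpotent hi).eq_zero, mul_zero]

/-- **hodge.S28** (Jannsen, Invent. Math. 107 (1992), Thm. 1 (b); Kleiman 1968 Thm. 3.5 for
finite generation modulo numerical equivalence). For `X` smooth projective of dimension `n`, the
algebra `Aⁿ_num(X × X) ⊗ K` of degree-`0` correspondences modulo numerical equivalence is finite
dimensional over `K` (a quotient of the finite-dimensional `Aⁿ_hom(X × X) ⊗ K`,
`corrAlgebra_finite`). [cite: Kleiman1968, Thm. 3.5] -/
theorem numCorrAlgebra_finite (hX : IsSmoothProjective n X) :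
    Module.Finite K (NumCorrAlgebra W n X) := by
  haveI := corrAlgebra_finite W hX
  exact Module.Finite.of_surjective (Ideal.Quotient.mkₐ K (numTrivialIdeal W n X)).toLinearMap
    (Ideal.Quotient.mkₐ_surjective K _)

/-- **hodge.S28** (Jannsen, Invent. Math. 107 (1992), Thm. 1, (c) ⇒ (b), and Cor. 1: numerical
motives form a semisimple abelian category; Scholl 1994 §3, Thm. 3.4). For `X` smooth projective
of dimension `n`, the algebra `Aⁿ_num(X × X) ⊗ K` of degree-`0` correspondences modulo numerical
equivalence is a semisimple ring: it is a quotient of the semisimple ring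
`(Aⁿ_hom(X × X) ⊗ K) / rad`, the ideal of numerically trivial correspondences containing the
Jacobson radical of the artinian ring `Aⁿ_hom(X × X) ⊗ K` (`jacobson_le_numTrivialIdeal`).
[cite: Jannsen1992, Thm. 1 ((c) ⇒ (b)) and Cor. 1] -/
theorem isSemisimpleRing_numCorrAlgebra (hX : IsSmoothProjective n X) :
    IsSemisimpleRing (NumCorrAlgebra W n X) := by
  haveI := isArtinianRing_corrAlgebra W hX
  exact RingHom.isSemisimpleRing_of_surjective
    (Ideal.Quotient.factor (jacobson_le_numTrivialIdeal W hX))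
    (Ideal.Quotient.factor_surjective _)

end Hodge

/-! ## hodge.S23 (Zucker's clause): Hodge classes on Kähler manifolds need not be analytic -/

section Hodge

open scoped Manifold ContDiff

/-- A complex singular cohomology class `c ∈ Hⁿ(X; ℂ)` *is rational* if it is represented by a
cocycle with values in `ℚ ⊆ ℂ`, i.e. lies in the image of `Hⁿ(X; ℚ) → Hⁿ(X; ℂ)`
(Hatcher, *Algebraic Topology* §3.1; Voisin, *Hodge Theory I* §7.1.1, "rational classes").
Stated on G04's `singularCohomology ℂ ℂ X n` so as to be comparable with de Rham classes through
a `ComplexDeRhamIsoFamily`. [folklore] -/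
def IsRationalClass {X : Type u} [TopologicalSpace X] {n : ℕ}
    (c : Literature.AlgebraicTopology.SingularHomology.singularCohomology ℂ ℂ X n) : Prop :=
  ∃ (φ : Literature.AlgebraicTopology.SingularHomology.SingularSimplex X n → ℂ) (h : (Literature.AlgebraicTopology.SingularHomology.singularCochainComplex ℂ ℂ X).d n (n + 1) φ = 0),
    (∀ σ, φ σ ∈ Set.range ((↑) : ℚ → ℂ)) ∧
      Literature.AlgebraicTopology.SingularHomology.singularCohomology.π ℂ ℂ X n (Literature.AlgebraicTopology.SingularHomology.singularCochainComplex.cocyclesMk φ h) = c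

/-- The zero class is rational. [folklore] -/
lemma isRationalClass_zero {X : Type u} [TopologicalSpace X] {n : ℕ} :
    IsRationalClass (0 : Literature.AlgebraicTopology.SingularHomology.singularCohomology ℂ ℂ X n) := by
  refine ⟨0, map_zero _, fun _ ↦ ⟨0, by simp⟩, ?_⟩
  have h0 : Literature.AlgebraicTopology.SingularHomology.singularCochainComplex.cocyclesMk (R := ℂ) (M := ℂ) (X := X) (n := n) 0
      (map_zero _) = 0 := by
    apply (ModuleCat.mono_iff_injective (Literature.AlgebraicTopology.SingularHomology.singularCochainComplex.iCocycles ℂ ℂ X n)).1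
      inferInstance
    rw [Literature.AlgebraicTopology.SingularHomology.singularCochainComplex.iCocycles_mk, map_zero]
    rfl
  rw [h0, map_zero]

/-- **hodge.S23** (Zucker, Compositio Math. 34 (1977), Appendix B; quoted in Voisin, IMRN 2002
no. 20, §1: "the Hodge conjecture is false for Kähler manifolds, Hodge classes not being in
general classes of analytic cycles"). There is a compact connected Kähler manifold `M`
(a complex torus: `M` is homeomorphic to `(S¹)²ⁿ`, `n = dim_ℂ M`), a codimension `0 < p < n`, and
a **non-zero rational Hodge class of type `(p, p)`** on `M` — a class in
`H^{p,p}(M) ⊆ H²ᵖ_dR(M; ℂ)` (`Literature.NumberTheory.Transcendental.hodgePQ`) whose singular image under the natural de Rham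
isomorphism (`Literature.NumberTheory.Transcendental.ComplexDeRhamIsoFamily`, `exists_complexDeRhamIsoFamily`) is rational and
non-zero — while `M` contains **no analytic subset of pure codimension `p`**
(`Literature.Geometry.Kaehler.HasPureCodim`), so that this Hodge class is not a `ℚ`-combination of classes of analytic
cycles. The class is quantified over *all* natural de Rham isomorphism families, so no choice
enters. Printed source (Voisin, arXiv:math/0112247 = IMRN 2002 no. 20, §1, p. 2): "the conjecture
above, where the algebraic subvarieties are replaced with closed analytic subsets, is known to be
false (cf. [Zu]). The simplest example is provided by a complex torus endowed with a holomorphic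
line bundle of indefinite curvature. If the torus is chosen general enough, it will not contain
any analytic hypersurface, while the first Chern class of the line bundle will provide a Hodge
class of degree 2" — i.e. the case `p = 1` of the existential below (we do not pin `p`).
**Not covered (Voisin's Thm 1):** the coherent-sheaf strengthening `c₂(𝓕) = 0` for all coherent
`𝓕` on a `4`-dimensional Weil torus; see the module docstring. Named fact (published theorem
not in Mathlib; the Kähler package `IsKaehlerManifold`/`hodgePQ`/`HasPureCodim` has no torus
examples yet). [cite: Voisin2002, §1 (p. 2)] [cite: Zucker1977, App. B] -/
def zucker_exists_hodgeClass_not_analytic : Prop :=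
    ∃ (n : ℕ) (M : Type) (_ : TopologicalSpace M) (_ : ChartedSpace (Fin n → ℂ) M)
      (_ : IsManifold 𝓘(ℂ, Fin n → ℂ) ω M) (_ : IsManifold 𝓘(ℝ, Fin n → ℂ) ∞ M)
      (_ : T2Space M) (_ : CompactSpace M) (_ : ConnectedSpace M)
      (_ : Literature.Geometry.Kaehler.IsKaehlerManifold (Fin n → ℂ) M) (_ : M ≃ₜ (Fin (2 * n) → AddCircle (1 : ℝ)))
      (p : ℕ), 0 < p ∧ p < n ∧
      (∀ Z : Set M, ¬ Literature.Geometry.Kaehler.HasPureCodim 𝓘(ℂ, Fin n → ℂ) Z p) ∧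
      ∀ e : Literature.NumberTheory.Transcendental.ComplexDeRhamIsoFamily (Fin n → ℂ), e.IsNatural →
        ∃ c ∈ Literature.NumberTheory.Transcendental.hodgePQ (Fin n → ℂ) M (2 * p) p p,
          IsRationalClass (e M (2 * p) c) ∧ e M (2 * p) c ≠ 0

/-- Consequence of Zucker's clause in the form usually quoted (Voisin 2002 §1): the Kähler
analogue of the Hodge conjecture *with analytic cycles* fails — some compact Kähler manifold
carries a non-zero rational Hodge class of a type `(p, p)` for which it has no analytic subset of
pure codimension `p` at all. [cite: Voisin2002, §1 (p. 2)] -/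
theorem zucker_exists_hodgeClass_not_analytic.exists_kaehler
    (h : zucker_exists_hodgeClass_not_analytic) :
    ∃ (n : ℕ) (M : Type) (_ : TopologicalSpace M) (_ : ChartedSpace (Fin n → ℂ) M)
      (_ : IsManifold 𝓘(ℂ, Fin n → ℂ) ω M) (_ : IsManifold 𝓘(ℝ, Fin n → ℂ) ∞ M)
      (_ : T2Space M) (_ : CompactSpace M) (_ : Literature.Geometry.Kaehler.IsKaehlerManifold (Fin n → ℂ) M) (p : ℕ),
      (∀ Z : Set M, ¬ Literature.Geometry.Kaehler.HasPureCodim 𝓘(ℂ, Fin n → ℂ) Z p) ∧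
      ∀ e : Literature.NumberTheory.Transcendental.ComplexDeRhamIsoFamily (Fin n → ℂ), e.IsNatural →
        ∃ c ∈ Literature.NumberTheory.Transcendental.hodgePQ (Fin n → ℂ) M (2 * p) p p,
          IsRationalClass (e M (2 * p) c) ∧ e M (2 * p) c ≠ 0 := by
  obtain ⟨n, M, _, _, _, _, _, _, _, _, _, p, -, -, hZ, hc⟩ := h
  exact ⟨n, M, _, _, ‹_›, ‹_›, ‹_›, ‹_›, ‹_›, p, hZ, hc⟩

end Hodge

end Literature.AlgebraicGeometry.Motives

end
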